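import Literature.RingTheory.Flat.BasisLiftNilpotent
import Mathlib.RingTheory.TensorProduct.IsBaseChangeFree
import HarnessLib

/-!
# [Schlessinger1968, Lemma 3.4] (free case, as in the printed proof; and as stated, for `M'` flat over an Artin
# local `A'`): the fibre product `N = M' ×_M M''` over `B = A' ×_A A''` is free, and its projections are base changes

Family `hodge` (computation cell `pub-hsemireg`, LIT-W seat «Pridham / derived deformation theory as printed»), layer
`Literature/RingTheory/Flat`. [Schlessinger1968, Lemma 3.4, pp. 216–217] AS PRINTED:

«LEMMA 3.4. Consider a commutative diagram [`N → M'`, `N → M''`, `M' → M ← M''`, `p'`, `p''`, `u'`, `u''`] of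
compatible ring and module homomorphisms, where `B = A' ×_A A''`, `N = M' ×_M M''` and `M'` (resp. `M''`) is a flat
`A'` (resp. `A''`) module. Suppose (i) `A''/J ≅ A`, where `J` is a nilpotent ideal in `A''`, (ii) `u'` (resp. `u''`)
induces `M' ⊗_{A'} A ≅ M` (resp. `M'' ⊗_{A''} A ≅ M`). Then `N` is flat over `B` and `p'` (resp. `p''`) induces
`N ⊗_B A' ≅ M'` (resp. `N ⊗_B A'' ≅ M''`).
Proof. We shall consider only the case where `M'` is actually a free `A'` module. (This case actually suffices for
our purposes, since a simple application of Lemma 3.3 shows that a flat module over an Artin local ring is free.)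
Choose a basis `(x'_i)_{i∈I}` for `M'`. Then by (ii) we find that `M` is the free module on generators `u'(x'_i)`. Choosing `x''_i ∈ M''` such that
`u''(x''_i) = u'(x'_i)`, we get a map `Σ A'' x''_i → M''` of `A''` modules, whose reduction modulo the ideal `J` is
an isomorphism. Therefore `M''` is free on generators `x''_i` (Lemma 3.3) and it follows easily that `N = M' ×_M M''`
is free on generators `x'_i × x''_i`, and that the projections on the factors induce isomorphisms `N ⊗_B A' ≅ M'`,
`N ⊗_B A'' ≅ M''` as desired.»

TYPED HERE — the free case, exactly as the printed proof runs. Rings: a commutative square of algebras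
`R₃ → R₁ → R₀`, `R₃ → R₂ → R₀` (`[Algebra R₃ R₁] [Algebra R₁ R₀] [Algebra R₃ R₂] [Algebra R₂ R₀] [Algebra R₃ R₀]`
with the two scalar towers; `R₃ = B`, `R₁ = A'`, `R₂ = A''`, `R₀ = A`) which is CARTESIAN (`R₃ ≅ R₁ ×_{R₀} R₂`:
compatible pairs lift uniquely — any model, as in the tree's `IsCartesian`); (i) = `algebraMap R₂ R₀` surjective with
nilpotent kernel `J`. Modules: `M₁` over `R₁` with basis `b₁` («choose a basis `(x'_i)`»), `M₀` over `R₀` with basis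
`b₀ i = u₁ (b₁ i)` («by (ii) … `M` is the free module on generators `u'(x'_i)`» — hypothesis (ii) for `u'` in the form
the proof uses), `M₂` FLAT over `R₂` with `u₂ : M₂ → M₀` semilinear, SURJECTIVE with `ker u₂ = J · M₂` ((ii) for
`u''`: «induces `M'' ⊗_{A''} A ≅ M`»); the `R₃`-module structures on `M₁`, `M₂` are the restrictions of scalars
(`IsScalarTower`). `N` = the `R₃`-submodule `{(m₁, m₂) | u₁ m₁ = u₂ m₂}` of `M₁ × M₂` (`fiberProd R₃ u₁ u₂`).
* `exists_basis_fiberProd_of_bases` — the linear algebra: for bases `b₁`, `b₂`, `b₀` with `u'(b₁ i) = b₀ i = u''(b₂ i)`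
  over a cartesian square, the pairs `b₁ i × b₂ i` form a `B`-basis of `N` (no flatness used);
* `exists_basis_fiberProd` — «`M''` is free on generators `x''_i` (Lemma 3.3) and … `N = M' ×_M M''` is free on
  generators `x'_i × x''_i`» (`x''_i` from `BasisLiftNilpotent.exists_basis_of_lift_basis`);
* `free_fiberProd`, `flat_fiberProd` — «Then `N` is flat over `B`»;
* `isBaseChange_fiberProdFst`, `isBaseChange_fiberProdSnd` — «the projections on the factors induce isomorphisms
  `N ⊗_B A' ≅ M'`, `N ⊗_B A'' ≅ M''`» (Mathlib `IsBaseChange`, via `IsBaseChange.of_basis` ∕ `comp_equiv`).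
* [Cor. 3.6]: `surjective_algebraMap_of_cartesian`, `isNilpotent_ker_algebraMap_of_cartesian` (`B → A'` is surjective
  with nilpotent kernel `J_B`), `ker_fiberProdFst_eq` (`ker p' = J_B N`), `fiberProdLift` (`q' × q''`) and
  **`bijective_fiberProdLift`** — «COROLLARY 3.6 … the canonical morphism `q' × q'' : L → N` is an isomorphism. Proof.
  Apply Lemma 3.3 to the morphism `u = q' × q''`.»
* § «As stated, for `A'` Artin local»: the printed reduction «a flat module over an Artin local ring is free» (the
  tree's `free_of_flat_of_isArtinianRing`, [Schlessinger1968, p. 217]) turns the free case into LEMMA 3.4 AS STATED —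
  `M'` FLAT over an ARTIN LOCAL `A'`, hypothesis (ii) for `u'` in its printed form «`u'` induces `M' ⊗_{A'} A ≅ M`» =
  Mathlib `IsBaseChange R₀ (restrictSemilinear u₁)` (`u'` read `A'`-linearly into `M` with scalars restricted along
  `A' → A`): `exists_basis_of_isBaseChange` (then `u'(x'_i)` IS a basis of `M`), `free_fiberProd_of_isBaseChange`,
  **`flat_fiberProd_of_isBaseChange`**, **`isBaseChange_fiberProdFst_of_isBaseChange`**,
  **`isBaseChange_fiberProdSnd_of_isBaseChange`**, and Cor. 3.6 in the same generality,
  `bijective_fiberProdLift_of_isBaseChange`.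
Definitions with body (`fiberProd`, its projections, `fiberProdPair`, `fiberProdLift`, `restrictSemilinear`) and
theorems; no named fact, no `sorry`. Not here: `M'` flat over an `A'` that is NOT Artin local («A similar argument for
the case of general `M'` is given in [4, §1, Proposition 2]» = Bourbaki, Alg. Comm.).

## References
* [Schlessinger1968] M. Schlessinger, Functors of Artin rings, Trans. AMS 130 (1968): Lemma 3.4 and proof, Cor. 3.6, pp. 216–217
  (held text `paper:doi-10-1090-s0002-9947-1968-0217093-3`, p0009–p0010).
-/

universe u₀ u₁ u₂ u₃ v₀ v₁ v₂ z

namespace Literature.RingTheory.Flat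

open Literature.RingTheory.AdicTopology (finsupp_mem_smul_top_of_forall_mem)

variable (R₃ : Type u₃) {R₁ : Type u₁} {R₂ : Type u₂} {R₀ : Type u₀}
  [CommRing R₃] [CommRing R₁] [CommRing R₂] [CommRing R₀]
  [Algebra R₃ R₁] [Algebra R₃ R₂] [Algebra R₁ R₀] [Algebra R₂ R₀] [Algebra R₃ R₀]
  [IsScalarTower R₃ R₁ R₀] [IsScalarTower R₃ R₂ R₀]
  {M₁ : Type v₁} {M₂ : Type v₂} {M₀ : Type v₀}
  [AddCommGroup M₁] [Module R₁ M₁] [Module R₃ M₁] [IsScalarTower R₃ R₁ M₁]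
  [AddCommGroup M₂] [Module R₂ M₂] [Module R₃ M₂] [IsScalarTower R₃ R₂ M₂]
  [AddCommGroup M₀] [Module R₀ M₀]
  (u₁ : M₁ →ₛₗ[algebraMap R₁ R₀] M₀) (u₂ : M₂ →ₛₗ[algebraMap R₂ R₀] M₀)

/-- **`N = M' ×_M M''`** as a `B = R₃`-submodule of `M' × M''`: the pairs `(m₁, m₂)` with `u₁ m₁ = u₂ m₂` (closed under
the `R₃`-action because the square of rings commutes: both composites are `algebraMap R₃ R₀`).
[cite: Schlessinger1968, Lemma 3.4, p. 216] -/
def fiberProd : Submodule R₃ (M₁ × M₂) where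
  carrier := {x | u₁ x.1 = u₂ x.2}
  add_mem' {x y} hx hy := by
    simp only [Set.mem_setOf_eq, Prod.fst_add, Prod.snd_add, map_add] at hx hy ⊢
    rw [hx, hy]
  zero_mem' := by simp
  smul_mem' d x hx := by
    simp only [Set.mem_setOf_eq, Prod.smul_fst, Prod.smul_snd] at hx ⊢
    rw [← IsScalarTower.algebraMap_smul R₁ d x.1, ← IsScalarTower.algebraMap_smul R₂ d x.2, map_smulₛₗ,
      map_smulₛₗ, hx, ← IsScalarTower.algebraMap_apply, ← IsScalarTower.algebraMap_apply]

/-- Membership in `N`. [cite: Schlessinger1968, Lemma 3.4, p. 216] -/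
@[simp] theorem mem_fiberProd (x : M₁ × M₂) : x ∈ fiberProd R₃ u₁ u₂ ↔ u₁ x.1 = u₂ x.2 := Iff.rfl

/-- The projection `p' : N → M'` (`R₃`-linear). [cite: Schlessinger1968, Lemma 3.4, p. 216] -/
def fiberProdFst : fiberProd R₃ u₁ u₂ →ₗ[R₃] M₁ := (LinearMap.fst R₃ M₁ M₂).comp (fiberProd R₃ u₁ u₂).subtype

/-- The projection `p'' : N → M''` (`R₃`-linear). [cite: Schlessinger1968, Lemma 3.4, p. 216] -/
def fiberProdSnd : fiberProd R₃ u₁ u₂ →ₗ[R₃] M₂ := (LinearMap.snd R₃ M₁ M₂).comp (fiberProd R₃ u₁ u₂).subtype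

/-- `p'` on elements. [cite: Schlessinger1968, Lemma 3.4, p. 216] -/
@[simp] theorem fiberProdFst_apply (x : fiberProd R₃ u₁ u₂) : fiberProdFst R₃ u₁ u₂ x = (x : M₁ × M₂).1 := rfl

/-- `p''` on elements. [cite: Schlessinger1968, Lemma 3.4, p. 216] -/
@[simp] theorem fiberProdSnd_apply (x : fiberProd R₃ u₁ u₂) : fiberProdSnd R₃ u₁ u₂ x = (x : M₁ × M₂).2 := rfl

variable {u₁ u₂}

/-- The pair `x'_i × x''_i ∈ N` built from `u''(x''_i) = u'(x'_i)`. [cite: Schlessinger1968, Lemma 3.4 (proof), p. 217] -/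
def fiberProdPair {ι : Type z} (b₁ : ι → M₁) (b₂ : ι → M₂) (h : ∀ i, u₁ (b₁ i) = u₂ (b₂ i)) (i : ι) :
    fiberProd R₃ u₁ u₂ := ⟨(b₁ i, b₂ i), h i⟩

/-- `x'_i × x''_i` on elements. [cite: Schlessinger1968, Lemma 3.4 (proof), p. 217] -/
@[simp] theorem coe_fiberProdPair {ι : Type z} (b₁ : ι → M₁) (b₂ : ι → M₂) (h : ∀ i, u₁ (b₁ i) = u₂ (b₂ i)) (i : ι) :
    (fiberProdPair R₃ b₁ b₂ h i : M₁ × M₂) = (b₁ i, b₂ i) := rfl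

section Basis

variable {ι : Type z}
  (hc : ∀ (b : R₁) (a : R₂), algebraMap R₁ R₀ b = algebraMap R₂ R₀ a → ∃ d : R₃, algebraMap R₃ R₁ d = b ∧ algebraMap R₃ R₂ d = a)
  (hcu : ∀ d d' : R₃, algebraMap R₃ R₁ d = algebraMap R₃ R₁ d' → algebraMap R₃ R₂ d = algebraMap R₃ R₂ d' → d = d')

/-- `Σ d_i (x'_i × x''_i)` has components `Σ (d_i)_{A'} x'_i` and `Σ (d_i)_{A''} x''_i`.
[cite: Schlessinger1968, Lemma 3.4 (proof), p. 217] -/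
theorem coe_linearCombination_fiberProdPair (b₁ : ι → M₁) (b₂ : ι → M₂) (h : ∀ i, u₁ (b₁ i) = u₂ (b₂ i))
    (d : ι →₀ R₃) :
    ((Finsupp.linearCombination R₃ (fiberProdPair R₃ b₁ b₂ h) d : fiberProd R₃ u₁ u₂) : M₁ × M₂) =
      (Finsupp.linearCombination R₁ b₁ (d.mapRange (algebraMap R₃ R₁) (map_zero _)),
        Finsupp.linearCombination R₂ b₂ (d.mapRange (algebraMap R₃ R₂) (map_zero _))) := by
  rw [← Submodule.subtype_apply, Finsupp.apply_linearCombination, Finsupp.linearCombination_apply,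
    Finsupp.linearCombination_apply, Finsupp.linearCombination_apply,
    Finsupp.sum_mapRange_index (fun i => zero_smul R₁ (b₁ i)),
    Finsupp.sum_mapRange_index (fun i => zero_smul R₂ (b₂ i))]
  refine Prod.ext ?_ ?_
  · rw [Finsupp.sum, Finsupp.sum, Prod.fst_sum]
    exact Finset.sum_congr rfl fun i _ => by simp
  · rw [Finsupp.sum, Finsupp.sum, Prod.snd_sum]
    exact Finset.sum_congr rfl fun i _ => by simp

include hc hcu in
/-- **«`N = M' ×_M M''` is free on generators `x'_i × x''_i`» — the linear algebra:** for a CARTESIAN square of rings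
and bases `b₁` of `M'`, `b₂` of `M''`, `b₀` of `M` with `u'(b₁ i) = b₀ i = u''(b₂ i)`, the pairs `b₁ i × b₂ i` form an
`R₃ = B`-basis of `N` (independence: `lift_unique`; spanning: compare `b₀`-coordinates of `u' m₁ = u'' m₂` and lift
them to `B` by `exists_lift`). No flatness is used here. [cite: Schlessinger1968, Lemma 3.4 (proof), p. 217] -/
theorem exists_basis_fiberProd_of_bases (b₁ : Module.Basis ι R₁ M₁) (b₂ : Module.Basis ι R₂ M₂)
    (b₀ : Module.Basis ι R₀ M₀) (h₁ : ∀ i, u₁ (b₁ i) = b₀ i) (h₂ : ∀ i, u₂ (b₂ i) = b₀ i) :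
    ∃ e : Module.Basis ι R₃ (fiberProd R₃ u₁ u₂), ∀ i, (e i : M₁ × M₂) = (b₁ i, b₂ i) := by
  classical
  have h : ∀ i, u₁ (b₁ i) = u₂ (b₂ i) := fun i => (h₁ i).trans (h₂ i).symm
  -- linear independence over `R₃`
  have hli : LinearIndependent R₃ (fiberProdPair R₃ (u₁ := u₁) (u₂ := u₂) b₁ b₂ h) := by
    rw [linearIndependent_iff]
    intro d hd
    have hd' := congrArg (fun x : fiberProd R₃ u₁ u₂ => (x : M₁ × M₂)) hd
    simp only [coe_linearCombination_fiberProdPair, Submodule.coe_zero, Prod.ext_iff, Prod.fst_zero,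
      Prod.snd_zero] at hd'
    have e₁ : d.mapRange (algebraMap R₃ R₁) (map_zero _) = 0 :=
      b₁.linearIndependent.finsuppLinearCombination_injective (by rw [hd'.1, map_zero])
    have e₂ : d.mapRange (algebraMap R₃ R₂) (map_zero _) = 0 :=
      b₂.linearIndependent.finsuppLinearCombination_injective (by rw [hd'.2, map_zero])
    ext i
    have e₁i := DFunLike.congr_fun e₁ i
    have e₂i := DFunLike.congr_fun e₂ i
    rw [Finsupp.mapRange_apply, Finsupp.zero_apply] at e₁i e₂i
    rw [Finsupp.zero_apply]
    exact hcu _ _ (by rw [e₁i, map_zero]) (by rw [e₂i, map_zero])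
  -- spanning
  have hsp : ⊤ ≤ Submodule.span R₃ (Set.range (fiberProdPair R₃ (u₁ := u₁) (u₂ := u₂) b₁ b₂ h)) := by
    rintro ⟨⟨m₁, m₂⟩, hx⟩ -
    set r := b₁.repr m₁ with hr
    set s := b₂.repr m₂ with hs
    have hm₁ : Finsupp.linearCombination R₁ b₁ r = m₁ := b₁.linearCombination_repr m₁
    have hm₂ : Finsupp.linearCombination R₂ b₂ s = m₂ := b₂.linearCombination_repr m₂
    -- compare `b₀`-coordinates of `u₁ m₁ = u₂ m₂`
    have key : r.mapRange (algebraMap R₁ R₀) (map_zero _) = s.mapRange (algebraMap R₂ R₀) (map_zero _) := by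
      apply b₀.linearIndependent.finsuppLinearCombination_injective
      change Finsupp.linearCombination R₀ b₀ _ = Finsupp.linearCombination R₀ b₀ _
      rw [← apply_linearCombination_eq_of_lift u₁ b₀ b₁ h₁, ← apply_linearCombination_eq_of_lift u₂ b₀ b₂ h₂,
        hm₁, hm₂]
      exact hx
    have keyi : ∀ i, algebraMap R₁ R₀ (r i) = algebraMap R₂ R₀ (s i) := fun i => by
      have := DFunLike.congr_fun key i
      rwa [Finsupp.mapRange_apply, Finsupp.mapRange_apply] at this
    choose dfun hdfun using fun i => hc (r i) (s i) (keyi i)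
    have hzero : ∀ i, i ∉ r.support ∪ s.support → dfun i = 0 := by
      intro i hi
      rw [Finset.mem_union, not_or, Finsupp.mem_support_iff, Finsupp.mem_support_iff, not_not, not_not] at hi
      exact hcu _ _ (by rw [(hdfun i).1, hi.1, map_zero]) (by rw [(hdfun i).2, hi.2, map_zero])
    let d : ι →₀ R₃ := Finsupp.onFinset (r.support ∪ s.support) dfun fun i hi => by
      by_contra hmem
      exact hi (hzero i hmem)
    have hd : ∀ i, d i = dfun i := fun i => Finsupp.onFinset_apply
    have hd₁ : d.mapRange (algebraMap R₃ R₁) (map_zero _) = r := by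
      ext i; rw [Finsupp.mapRange_apply, hd, (hdfun i).1]
    have hd₂ : d.mapRange (algebraMap R₃ R₂) (map_zero _) = s := by
      ext i; rw [Finsupp.mapRange_apply, hd, (hdfun i).2]
    have hxd : (⟨(m₁, m₂), hx⟩ : fiberProd R₃ u₁ u₂) = Finsupp.linearCombination R₃ (fiberProdPair R₃ b₁ b₂ h) d := by
      apply Subtype.ext
      rw [coe_linearCombination_fiberProdPair, hd₁, hd₂, hm₁, hm₂]
    rw [hxd, ← Finsupp.range_linearCombination]
    exact LinearMap.mem_range_self _ d
  exact ⟨Module.Basis.mk hli hsp, fun i => by rw [Module.Basis.mk_apply]; rfl⟩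

include hc hcu in
/-- **[Schlessinger1968, Lemma 3.4 (proof)]: «Therefore `M''` is free on generators `x''_i` (Lemma 3.3) and it follows
easily that `N = M' ×_M M''` is free on generators `x'_i × x''_i`».** Cartesian square with `A'' → A` surjective with
nilpotent kernel `J`; `M'` free on `b₁`, `M` free on `u'(b₁ i)` ((ii) for `u'`); `M''` FLAT, `u''` surjective with
`ker u'' = J M''` ((ii) for `u''`). [cite: Schlessinger1968, Lemma 3.4 and proof, pp. 216–217] -/
theorem exists_basis_fiberProd [Module.Flat R₂ M₂] (hq : Function.Surjective (algebraMap R₂ R₀))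
    (hJ : IsNilpotent (RingHom.ker (algebraMap R₂ R₀))) (hu₂ : Function.Surjective u₂)
    (hker : LinearMap.ker u₂ = RingHom.ker (algebraMap R₂ R₀) • ⊤)
    (b₁ : Module.Basis ι R₁ M₁) (b₀ : Module.Basis ι R₀ M₀) (h₁ : ∀ i, u₁ (b₁ i) = b₀ i) :
    ∃ (b₂ : Module.Basis ι R₂ M₂) (e : Module.Basis ι R₃ (fiberProd R₃ u₁ u₂)),
      (∀ i, u₂ (b₂ i) = b₀ i) ∧ ∀ i, (e i : M₁ × M₂) = (b₁ i, b₂ i) := by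
  -- «Choosing `x''_i ∈ M''` such that `u''(x''_i) = u'(x'_i)`»
  choose x hx using fun i => hu₂ (b₀ i)
  obtain ⟨b₂, hb₂⟩ := exists_basis_of_lift_basis hq hJ u₂ hker b₀ x hx
  have h₂ : ∀ i, u₂ (b₂ i) = b₀ i := fun i => by rw [hb₂, hx]
  obtain ⟨e, he⟩ := exists_basis_fiberProd_of_bases R₃ hc hcu b₁ b₂ b₀ h₁ h₂
  exact ⟨b₂, e, h₂, he⟩

include hc hcu in
/-- **[Schlessinger1968, Lemma 3.4]: «Then `N` is flat over `B`»** — indeed free (free case of the printed proof).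
[cite: Schlessinger1968, Lemma 3.4, pp. 216–217] -/
theorem free_fiberProd [Module.Flat R₂ M₂] (hq : Function.Surjective (algebraMap R₂ R₀))
    (hJ : IsNilpotent (RingHom.ker (algebraMap R₂ R₀))) (hu₂ : Function.Surjective u₂)
    (hker : LinearMap.ker u₂ = RingHom.ker (algebraMap R₂ R₀) • ⊤)
    (b₁ : Module.Basis ι R₁ M₁) (b₀ : Module.Basis ι R₀ M₀) (h₁ : ∀ i, u₁ (b₁ i) = b₀ i) :
    Module.Free R₃ (fiberProd R₃ u₁ u₂) := by
  obtain ⟨-, e, -, -⟩ := exists_basis_fiberProd R₃ hc hcu hq hJ hu₂ hker b₁ b₀ h₁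
  exact Module.Free.of_basis e

include hc hcu in
/-- **[Schlessinger1968, Lemma 3.4]: «Then `N` is flat over `B`».** [cite: Schlessinger1968, Lemma 3.4, pp. 216–217] -/
theorem flat_fiberProd [Module.Flat R₂ M₂] (hq : Function.Surjective (algebraMap R₂ R₀))
    (hJ : IsNilpotent (RingHom.ker (algebraMap R₂ R₀))) (hu₂ : Function.Surjective u₂)
    (hker : LinearMap.ker u₂ = RingHom.ker (algebraMap R₂ R₀) • ⊤)
    (b₁ : Module.Basis ι R₁ M₁) (b₀ : Module.Basis ι R₀ M₀) (h₁ : ∀ i, u₁ (b₁ i) = b₀ i) :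
    Module.Flat R₃ (fiberProd R₃ u₁ u₂) := by
  haveI := free_fiberProd R₃ hc hcu hq hJ hu₂ hker b₁ b₀ h₁
  infer_instance

/-- A basis `e` of `N` lying over `b₁`: the projection `p' : N → M'` is `Σ_I B e_i → M'`, `e_i ↦ b₁ i`, after `e.repr`.
[cite: Schlessinger1968, Lemma 3.4 (proof), p. 217] -/
theorem fiberProdFst_eq_linearCombination_comp (b₁ : ι → M₁) (e : Module.Basis ι R₃ (fiberProd R₃ u₁ u₂))
    (he : ∀ i, ((e i : fiberProd R₃ u₁ u₂) : M₁ × M₂).1 = b₁ i) :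
    fiberProdFst R₃ u₁ u₂ = (Finsupp.linearCombination R₃ b₁).comp e.repr.toLinearMap := by
  refine e.ext fun i => ?_
  rw [fiberProdFst_apply, he, LinearMap.comp_apply, LinearEquiv.coe_toLinearMap, Module.Basis.repr_self,
    Finsupp.linearCombination_single, one_smul]

/-- Same for `p'' : N → M''`. [cite: Schlessinger1968, Lemma 3.4 (proof), p. 217] -/
theorem fiberProdSnd_eq_linearCombination_comp (b₂ : ι → M₂) (e : Module.Basis ι R₃ (fiberProd R₃ u₁ u₂))
    (he : ∀ i, ((e i : fiberProd R₃ u₁ u₂) : M₁ × M₂).2 = b₂ i) :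
    fiberProdSnd R₃ u₁ u₂ = (Finsupp.linearCombination R₃ b₂).comp e.repr.toLinearMap := by
  refine e.ext fun i => ?_
  rw [fiberProdSnd_apply, he, LinearMap.comp_apply, LinearEquiv.coe_toLinearMap, Module.Basis.repr_self,
    Finsupp.linearCombination_single, one_smul]

include hc hcu in
/-- **[Schlessinger1968, Lemma 3.4]: «`p'` induces `N ⊗_B A' ≅ M'`»** (Mathlib `IsBaseChange`: `M'` is the base
change of `N` along `B → A'` via `p'`). [cite: Schlessinger1968, Lemma 3.4, pp. 216–217] -/
theorem isBaseChange_fiberProdFst [Module.Flat R₂ M₂] (hq : Function.Surjective (algebraMap R₂ R₀))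
    (hJ : IsNilpotent (RingHom.ker (algebraMap R₂ R₀))) (hu₂ : Function.Surjective u₂)
    (hker : LinearMap.ker u₂ = RingHom.ker (algebraMap R₂ R₀) • ⊤)
    (b₁ : Module.Basis ι R₁ M₁) (b₀ : Module.Basis ι R₀ M₀) (h₁ : ∀ i, u₁ (b₁ i) = b₀ i) :
    IsBaseChange R₁ (fiberProdFst R₃ u₁ u₂) := by
  obtain ⟨b₂, e, -, he⟩ := exists_basis_fiberProd R₃ hc hcu hq hJ hu₂ hker b₁ b₀ h₁
  rw [fiberProdFst_eq_linearCombination_comp R₃ b₁ e fun i => by rw [he]]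
  exact IsBaseChange.comp_equiv e.repr _ (IsBaseChange.of_basis R₃ b₁)

include hc hcu in
/-- **[Schlessinger1968, Lemma 3.4]: «`p''` induces `N ⊗_B A'' ≅ M''`»** (Mathlib `IsBaseChange`).
[cite: Schlessinger1968, Lemma 3.4, pp. 216–217] -/
theorem isBaseChange_fiberProdSnd [Module.Flat R₂ M₂] (hq : Function.Surjective (algebraMap R₂ R₀))
    (hJ : IsNilpotent (RingHom.ker (algebraMap R₂ R₀))) (hu₂ : Function.Surjective u₂)
    (hker : LinearMap.ker u₂ = RingHom.ker (algebraMap R₂ R₀) • ⊤)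
    (b₁ : Module.Basis ι R₁ M₁) (b₀ : Module.Basis ι R₀ M₀) (h₁ : ∀ i, u₁ (b₁ i) = b₀ i) :
    IsBaseChange R₂ (fiberProdSnd R₃ u₁ u₂) := by
  obtain ⟨b₂, e, -, he⟩ := exists_basis_fiberProd R₃ hc hcu hq hJ hu₂ hker b₁ b₀ h₁
  rw [fiberProdSnd_eq_linearCombination_comp R₃ b₂ e fun i => by rw [he]]
  exact IsBaseChange.comp_equiv e.repr _ (IsBaseChange.of_basis R₃ b₂)

/-! ## [Schlessinger1968, Corollary 3.6]: a `B`-module over the diagram with `L ⊗_B A' ≅ M'` IS the fibre product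

«COROLLARY 3.6. With the notations as above, let `L` be a `B` module which may be inserted in a commutative diagram
[`L → M'`, `L → M''` over `u'`, `u''`] where `q'` induces `L ⊗_B A' ≅ M'`. Then the canonical morphism
`q' × q'' : L → N = M' ×_M M''` is an isomorphism. Proof. Apply Lemma 3.3 to the morphism `u = q' × q''`.» (p. 217).
Here `B → A'` is surjective with nilpotent kernel `J_B` (from (i) and the cartesian square:
`surjective_algebraMap_of_cartesian`, `isNilpotent_ker_algebraMap_of_cartesian`), so `L ⊗_B A' = L/J_B L` and the
hypothesis is read, as for (ii), as «`q'` surjective with `ker q' = J_B · L`»; `N` is flat by Lemma 3.4 and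
`ū : L/J_B L → N/J_B N` is bijective because both sides map isomorphically to `M'` (`ker_fiberProdFst_eq`). -/

omit [Algebra R₃ R₀] [IsScalarTower R₃ R₁ R₀] [IsScalarTower R₃ R₂ R₀] in
/-- The side `B → A'` of the cartesian square is SURJECTIVE when `A'' → A` is (lift `(b, a)` with `a ↦ image of b`).
[cite: Schlessinger1968, Lemma 3.4 (i) and §1 p. 209 (fibre products), pp. 216–217] -/
theorem surjective_algebraMap_of_cartesian
    (hc : ∀ (b : R₁) (a : R₂), algebraMap R₁ R₀ b = algebraMap R₂ R₀ a →
      ∃ d : R₃, algebraMap R₃ R₁ d = b ∧ algebraMap R₃ R₂ d = a)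
    (hq : Function.Surjective (algebraMap R₂ R₀)) : Function.Surjective (algebraMap R₃ R₁) := by
  intro b
  obtain ⟨a, ha⟩ := hq (algebraMap R₁ R₀ b)
  obtain ⟨d, hd, -⟩ := hc b a ha.symm
  exact ⟨d, hd⟩

/-- The kernel of `B → A'` maps into `J = ker (A'' → A)` under `B → A''` (the square commutes).
[cite: Schlessinger1968, Lemma 3.4, pp. 216–217] -/
theorem map_ker_algebraMap_le :
    (RingHom.ker (algebraMap R₃ R₁)).map (algebraMap R₃ R₂) ≤ RingHom.ker (algebraMap R₂ R₀) := by
  rw [Ideal.map_le_iff_le_comap]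
  intro d hd
  rw [RingHom.mem_ker] at hd
  rw [Ideal.mem_comap, RingHom.mem_ker, ← IsScalarTower.algebraMap_apply, IsScalarTower.algebraMap_apply R₃ R₁ R₀,
    hd, map_zero]

/-- **The kernel of `B → A'` is NILPOTENT** when `J = ker (A'' → A)` is and lifts through the square are unique: an
element of `(ker)^{n+1}` has `A'`-component `0` and `A''`-component in `J^{n+1} ⊆ J^n = 0`, hence is `0`.
[cite: Schlessinger1968, Lemma 3.4 (i), pp. 216–217] -/
theorem isNilpotent_ker_algebraMap_of_cartesian
    (hcu : ∀ d d' : R₃, algebraMap R₃ R₁ d = algebraMap R₃ R₁ d' → algebraMap R₃ R₂ d = algebraMap R₃ R₂ d' → d = d')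
    (hJ : IsNilpotent (RingHom.ker (algebraMap R₂ R₀))) : IsNilpotent (RingHom.ker (algebraMap R₃ R₁)) := by
  obtain ⟨n, hn⟩ := hJ
  refine ⟨n + 1, ?_⟩
  rw [Submodule.zero_eq_bot, eq_bot_iff]
  intro x hx
  rw [Submodule.mem_bot]
  have hx₁ : algebraMap R₃ R₁ x = 0 := by
    have : x ∈ RingHom.ker (algebraMap R₃ R₁) := Ideal.pow_le_self (Nat.succ_ne_zero n) hx
    exact this
  have hx₂ : algebraMap R₃ R₂ x = 0 := by
    have hmem : algebraMap R₃ R₂ x ∈ (RingHom.ker (algebraMap R₂ R₀)) ^ (n + 1) := by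
      have := Ideal.mem_map_of_mem (algebraMap R₃ R₂) hx
      rw [Ideal.map_pow] at this
      exact Ideal.pow_right_mono (map_ker_algebraMap_le R₃) (n + 1) this
    have hle : (RingHom.ker (algebraMap R₂ R₀)) ^ (n + 1) ≤ (RingHom.ker (algebraMap R₂ R₀)) ^ n :=
      Ideal.pow_le_pow_right (Nat.le_succ n)
    have := hle hmem
    rw [hn, Submodule.zero_eq_bot, Submodule.mem_bot] at this
    exact this
  exact hcu x 0 (by rw [hx₁, map_zero]) (by rw [hx₂, map_zero])

/-- `J_B = ker (B → A')` kills `M'` (the `B`-action on `M'` factors through `A'`). [cite: Schlessinger1968, Lemma 3.4, p. 216] -/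
theorem ker_algebraMap_smul_top_eq_bot :
    RingHom.ker (algebraMap R₃ R₁) • (⊤ : Submodule R₃ M₁) = ⊥ := by
  rw [eq_bot_iff, Submodule.smul_le]
  intro d hd m _
  rw [RingHom.mem_ker] at hd
  rw [Submodule.mem_bot, ← IsScalarTower.algebraMap_smul R₁ d m, hd, zero_smul]

/-- `Σ_i c_i b_i` computed in `M'` through `B → A'`. [cite: Schlessinger1968, Lemma 3.4 (proof), p. 217] -/
theorem linearCombination_eq_mapRange (b : ι → M₁) (c : ι →₀ R₃) :
    Finsupp.linearCombination R₃ b c = Finsupp.linearCombination R₁ b (c.mapRange (algebraMap R₃ R₁) (map_zero _)) := by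
  rw [Finsupp.linearCombination_apply, Finsupp.linearCombination_apply,
    Finsupp.sum_mapRange_index (fun i => zero_smul R₁ (b i))]
  exact Finset.sum_congr rfl fun i _ => (IsScalarTower.algebraMap_smul R₁ (c i) (b i)).symm

include hc hcu in
/-- **`ker (p' : N → M') = J_B · N`** (`J_B = ker (B → A')`): in the basis `x'_i × x''_i` of `N`, `p'(Σ d_i e_i) =
Σ (d_i)_{A'} x'_i` vanishes iff every `d_i ∈ J_B`. [cite: Schlessinger1968, Lemma 3.4 (proof) and Cor. 3.6, p. 217] -/
theorem ker_fiberProdFst_eq [Module.Flat R₂ M₂] (hq : Function.Surjective (algebraMap R₂ R₀))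
    (hJ : IsNilpotent (RingHom.ker (algebraMap R₂ R₀))) (hu₂ : Function.Surjective u₂)
    (hker : LinearMap.ker u₂ = RingHom.ker (algebraMap R₂ R₀) • ⊤)
    (b₁ : Module.Basis ι R₁ M₁) (b₀ : Module.Basis ι R₀ M₀) (h₁ : ∀ i, u₁ (b₁ i) = b₀ i) :
    LinearMap.ker (fiberProdFst R₃ u₁ u₂) = RingHom.ker (algebraMap R₃ R₁) • ⊤ := by
  obtain ⟨b₂, e, -, he⟩ := exists_basis_fiberProd R₃ hc hcu hq hJ hu₂ hker b₁ b₀ h₁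
  refine le_antisymm ?_ ?_
  · intro n hn
    rw [LinearMap.mem_ker, fiberProdFst_eq_linearCombination_comp R₃ b₁ e (fun i => by rw [he]),
      LinearMap.comp_apply, LinearEquiv.coe_toLinearMap, linearCombination_eq_mapRange R₃ (R₁ := R₁)] at hn
    have h0 : (e.repr n).mapRange (algebraMap R₃ R₁) (map_zero _) = 0 :=
      b₁.linearIndependent.finsuppLinearCombination_injective (by rw [hn, map_zero])
    have hmem : e.repr n ∈ RingHom.ker (algebraMap R₃ R₁) • (⊤ : Submodule R₃ (ι →₀ R₃)) :=
      finsupp_mem_smul_top_of_forall_mem _ _ fun i => by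
        have := DFunLike.congr_fun h0 i
        rwa [Finsupp.mapRange_apply, Finsupp.zero_apply] at this
    have : n = Finsupp.linearCombination R₃ e (e.repr n) := (e.linearCombination_repr n).symm
    rw [this]
    have hmap := Submodule.mem_map_of_mem (f := Finsupp.linearCombination R₃ e) hmem
    rw [Submodule.map_smul''] at hmap
    exact Submodule.smul_mono le_rfl le_top hmap
  · rw [Submodule.smul_le]
    intro d hd n _
    rw [RingHom.mem_ker] at hd
    rw [LinearMap.mem_ker, map_smul, fiberProdFst_apply, ← IsScalarTower.algebraMap_smul R₁ d, hd, zero_smul]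

/-- The canonical morphism `q' × q'' : L → N = M' ×_M M''` of a `B`-module `L` over the diagram.
[cite: Schlessinger1968, Cor. 3.6, p. 217] -/
def fiberProdLift {L : Type*} [AddCommGroup L] [Module R₃ L] (q₁ : L →ₗ[R₃] M₁) (q₂ : L →ₗ[R₃] M₂)
    (h : ∀ x, u₁ (q₁ x) = u₂ (q₂ x)) : L →ₗ[R₃] fiberProd R₃ u₁ u₂ :=
  LinearMap.codRestrict (fiberProd R₃ u₁ u₂) (q₁.prod q₂) fun x => h x

/-- `q' × q''` on elements. [cite: Schlessinger1968, Cor. 3.6, p. 217] -/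
@[simp] theorem coe_fiberProdLift_apply {L : Type*} [AddCommGroup L] [Module R₃ L] (q₁ : L →ₗ[R₃] M₁)
    (q₂ : L →ₗ[R₃] M₂) (h : ∀ x, u₁ (q₁ x) = u₂ (q₂ x)) (x : L) :
    ((fiberProdLift R₃ q₁ q₂ h x : fiberProd R₃ u₁ u₂) : M₁ × M₂) = (q₁ x, q₂ x) := rfl

include hc hcu in
/-- **[Schlessinger1968, Corollary 3.6]** (free case of Lemma 3.4): under the hypotheses of Lemma 3.4, a `B`-module
`L` with `q' : L → M'`, `q'' : L → M''` over `u'`, `u''`, such that `q'` induces `L ⊗_B A' ≅ M'` — read as: `q'`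
surjective with `ker q' = J_B · L`, `J_B = ker (B → A')` — maps ISOMORPHICALLY onto `N = M' ×_M M''` by `q' × q''`.
«Proof. Apply Lemma 3.3 to the morphism `u = q' × q''`» (`J_B` nilpotent; `N` flat by Lemma 3.4; `ū` bijective since
`L/J_B L → M'` and `N/J_B N → M'` both are). [cite: Schlessinger1968, Cor. 3.6, p. 217, with Lemma 3.3 p. 216] -/
theorem bijective_fiberProdLift [Module.Flat R₂ M₂] (hq : Function.Surjective (algebraMap R₂ R₀))
    (hJ : IsNilpotent (RingHom.ker (algebraMap R₂ R₀))) (hu₂ : Function.Surjective u₂)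
    (hker : LinearMap.ker u₂ = RingHom.ker (algebraMap R₂ R₀) • ⊤)
    (b₁ : Module.Basis ι R₁ M₁) (b₀ : Module.Basis ι R₀ M₀) (h₁ : ∀ i, u₁ (b₁ i) = b₀ i)
    {L : Type*} [AddCommGroup L] [Module R₃ L] (q₁ : L →ₗ[R₃] M₁) (q₂ : L →ₗ[R₃] M₂)
    (h : ∀ x, u₁ (q₁ x) = u₂ (q₂ x)) (hq₁ : Function.Surjective q₁)
    (hkq₁ : LinearMap.ker q₁ = RingHom.ker (algebraMap R₃ R₁) • ⊤) :
    Function.Bijective (fiberProdLift R₃ q₁ q₂ h) := by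
  haveI := flat_fiberProd R₃ hc hcu hq hJ hu₂ hker b₁ b₀ h₁
  have hJB := isNilpotent_ker_algebraMap_of_cartesian (R₃ := R₃) hcu hJ
  have hkerN := ker_fiberProdFst_eq R₃ hc hcu hq hJ hu₂ hker b₁ b₀ h₁
  set J := RingHom.ker (algebraMap R₃ R₁) with hJdef
  set v := fiberProdLift R₃ q₁ q₂ h with hv
  have hfst : ∀ x, fiberProdFst R₃ u₁ u₂ (v x) = q₁ x := fun x => rfl
  refine bijective_of_bijective_mapQ_of_isNilpotent hJB v ⟨fun a b hab => ?_, fun m => ?_⟩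
  · obtain ⟨x, rfl⟩ := Submodule.Quotient.mk_surjective _ a
    obtain ⟨y, rfl⟩ := Submodule.Quotient.mk_surjective _ b
    rw [Submodule.mapQ_apply, Submodule.mapQ_apply, Submodule.Quotient.eq, ← map_sub] at hab
    rw [Submodule.Quotient.eq, ← hkq₁, LinearMap.mem_ker, ← hfst, ← Submodule.mem_bot (R := R₃),
      ← ker_algebraMap_smul_top_eq_bot (R₃ := R₃) (R₁ := R₁) (M₁ := M₁)]
    have := Submodule.mem_map_of_mem (f := fiberProdFst R₃ u₁ u₂) hab
    rw [Submodule.map_smul''] at this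
    exact Submodule.smul_mono le_rfl le_top this
  · obtain ⟨n, rfl⟩ := Submodule.Quotient.mk_surjective _ m
    obtain ⟨x, hx⟩ := hq₁ (fiberProdFst R₃ u₁ u₂ n)
    refine ⟨Submodule.Quotient.mk x, ?_⟩
    rw [Submodule.mapQ_apply, Submodule.Quotient.eq, ← hkerN, LinearMap.mem_ker, map_sub, hfst, hx, sub_self]

/-! ## [Schlessinger1968, Lemma 3.4] AS STATED, for `A'` ARTIN LOCAL: `M'` flat (hence free — the printed reduction)

«Proof. We shall consider only the case where `M'` is actually a free `A'` module. (This case actually suffices for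
our purposes, since a simple application of Lemma 3.3 shows that a flat module over an Artin local ring is free.)»
(p. 217). With `R₁ = A'` Artinian local and `M₁ = M'` FLAT, `M'` is free (`free_of_flat_of_isArtinianRing`, typed
in `IsomorphismModuloNilpotent.lean` from this very sentence); choosing a basis `(x'_i)` (`Module.Free.chooseBasis`),
hypothesis (ii) for `u'` in its printed form — «`u'` induces `M' ⊗_{A'} A ≅ M`», i.e. Mathlib's `IsBaseChange R₀`
for `u'` read as an `A'`-linear map into `M` (scalars of `M` restricted along `A' → A`: `[Module R₁ M₀]
[IsScalarTower R₁ R₀ M₀]`) — says exactly that `u'(x'_i) = h.equiv (1 ⊗ x'_i)` is a basis of `M` («by (ii) we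
find that `M` is the free module on generators `u'(x'_i)`»), and the free case above applies verbatim. -/

section ArtinLocal

variable [Module R₁ M₀] [IsScalarTower R₁ R₀ M₀]

variable (u₁) in
/-- `u' : M' → M` (semilinear over `A' → A`) as an `A'`-LINEAR map into `M` with scalars restricted along `A' → A`
— the form in which Mathlib's `IsBaseChange` reads hypothesis (ii) «`u'` induces `M' ⊗_{A'} A ≅ M`».
[cite: Schlessinger1968, Lemma 3.4 (ii), p. 216] -/
def restrictSemilinear : M₁ →ₗ[R₁] M₀ where
  toFun := u₁
  map_add' := map_add u₁
  map_smul' r m := by rw [map_smulₛₗ, RingHom.id_apply, algebraMap_smul]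

/-- `restrictSemilinear u₁` is `u₁` on elements. [cite: Schlessinger1968, Lemma 3.4 (ii), p. 216] -/
@[simp] theorem restrictSemilinear_apply (m : M₁) : restrictSemilinear u₁ m = u₁ m := rfl

/-- **«Then by (ii) we find that `M` is the free module on generators `u'(x'_i)`»**: if `u'` induces
`M' ⊗_{A'} A ≅ M` (`IsBaseChange`), the images `u'(x'_i)` of a basis of `M'` form a basis of `M` (transport of
Mathlib's `Module.Basis.baseChange` along `IsBaseChange.equiv`, `equiv_tmul`).
[cite: Schlessinger1968, Lemma 3.4 (proof), p. 217] -/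
theorem exists_basis_of_isBaseChange (h : IsBaseChange R₀ (restrictSemilinear u₁)) (b₁ : Module.Basis ι R₁ M₁) :
    ∃ b₀ : Module.Basis ι R₀ M₀, ∀ i, u₁ (b₁ i) = b₀ i :=
  ⟨(b₁.baseChange R₀).map h.equiv, fun i => by
    rw [Module.Basis.map_apply, Module.Basis.baseChange_apply, IsBaseChange.equiv_tmul, one_smul,
      restrictSemilinear_apply]⟩

include hc hcu in
/-- **[Schlessinger1968, Lemma 3.4] as stated, `A'` Artin local: `N = M' ×_M M''` is FREE over `B`** (`M'` flat over
the Artin local `A'` ⇒ free, p. 217; then the free case `free_fiberProd`).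
[cite: Schlessinger1968, Lemma 3.4 and proof, pp. 216–217] -/
theorem free_fiberProd_of_isBaseChange [IsArtinianRing R₁] [IsLocalRing R₁] [Module.Flat R₁ M₁] [Module.Flat R₂ M₂]
    (hq : Function.Surjective (algebraMap R₂ R₀)) (hJ : IsNilpotent (RingHom.ker (algebraMap R₂ R₀)))
    (hu₂ : Function.Surjective u₂) (hker : LinearMap.ker u₂ = RingHom.ker (algebraMap R₂ R₀) • ⊤)
    (hu₁ : IsBaseChange R₀ (restrictSemilinear u₁)) : Module.Free R₃ (fiberProd R₃ u₁ u₂) := by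
  haveI : Module.Free R₁ M₁ := free_of_flat_of_isArtinianRing
  obtain ⟨b₀, h₁⟩ := exists_basis_of_isBaseChange hu₁ (Module.Free.chooseBasis R₁ M₁)
  exact free_fiberProd R₃ hc hcu hq hJ hu₂ hker _ b₀ h₁

include hc hcu in
/-- **[Schlessinger1968, Lemma 3.4] as stated, `A'` Artin local: «Then `N` is flat over `B`»** — `M'` FLAT over the
Artin local ring `A'`, `M''` FLAT over `A''`, (i) `A'' → A` surjective with nilpotent kernel `J`, (ii) `u'` induces
`M' ⊗_{A'} A ≅ M` (`IsBaseChange`) and `u''` induces `M'' ⊗_{A''} A ≅ M` (`u''` onto, `ker u'' = J M''`), the square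
of rings cartesian. [cite: Schlessinger1968, Lemma 3.4, pp. 216–217] -/
theorem flat_fiberProd_of_isBaseChange [IsArtinianRing R₁] [IsLocalRing R₁] [Module.Flat R₁ M₁] [Module.Flat R₂ M₂]
    (hq : Function.Surjective (algebraMap R₂ R₀)) (hJ : IsNilpotent (RingHom.ker (algebraMap R₂ R₀)))
    (hu₂ : Function.Surjective u₂) (hker : LinearMap.ker u₂ = RingHom.ker (algebraMap R₂ R₀) • ⊤)
    (hu₁ : IsBaseChange R₀ (restrictSemilinear u₁)) : Module.Flat R₃ (fiberProd R₃ u₁ u₂) := by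
  haveI := free_fiberProd_of_isBaseChange R₃ hc hcu hq hJ hu₂ hker hu₁
  infer_instance

include hc hcu in
/-- **[Schlessinger1968, Lemma 3.4] as stated, `A'` Artin local: «`p'` induces `N ⊗_B A' ≅ M'`»** (`IsBaseChange`).
[cite: Schlessinger1968, Lemma 3.4, pp. 216–217] -/
theorem isBaseChange_fiberProdFst_of_isBaseChange [IsArtinianRing R₁] [IsLocalRing R₁] [Module.Flat R₁ M₁]
    [Module.Flat R₂ M₂] (hq : Function.Surjective (algebraMap R₂ R₀))
    (hJ : IsNilpotent (RingHom.ker (algebraMap R₂ R₀))) (hu₂ : Function.Surjective u₂)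
    (hker : LinearMap.ker u₂ = RingHom.ker (algebraMap R₂ R₀) • ⊤) (hu₁ : IsBaseChange R₀ (restrictSemilinear u₁)) :
    IsBaseChange R₁ (fiberProdFst R₃ u₁ u₂) := by
  haveI : Module.Free R₁ M₁ := free_of_flat_of_isArtinianRing
  obtain ⟨b₀, h₁⟩ := exists_basis_of_isBaseChange hu₁ (Module.Free.chooseBasis R₁ M₁)
  exact isBaseChange_fiberProdFst R₃ hc hcu hq hJ hu₂ hker _ b₀ h₁

include hc hcu in
/-- **[Schlessinger1968, Lemma 3.4] as stated, `A'` Artin local: «`p''` induces `N ⊗_B A'' ≅ M''`»** (`IsBaseChange`).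
[cite: Schlessinger1968, Lemma 3.4, pp. 216–217] -/
theorem isBaseChange_fiberProdSnd_of_isBaseChange [IsArtinianRing R₁] [IsLocalRing R₁] [Module.Flat R₁ M₁]
    [Module.Flat R₂ M₂] (hq : Function.Surjective (algebraMap R₂ R₀))
    (hJ : IsNilpotent (RingHom.ker (algebraMap R₂ R₀))) (hu₂ : Function.Surjective u₂)
    (hker : LinearMap.ker u₂ = RingHom.ker (algebraMap R₂ R₀) • ⊤) (hu₁ : IsBaseChange R₀ (restrictSemilinear u₁)) :
    IsBaseChange R₂ (fiberProdSnd R₃ u₁ u₂) := by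
  haveI : Module.Free R₁ M₁ := free_of_flat_of_isArtinianRing
  obtain ⟨b₀, h₁⟩ := exists_basis_of_isBaseChange hu₁ (Module.Free.chooseBasis R₁ M₁)
  exact isBaseChange_fiberProdSnd R₃ hc hcu hq hJ hu₂ hker _ b₀ h₁

include hc hcu in
/-- **[Schlessinger1968, Corollary 3.6] in the same generality** (`M'` flat over the Artin local `A'`, (ii) for `u'`
as `IsBaseChange`): `q' × q'' : L → N` is bijective when `q'` induces `L ⊗_B A' ≅ M'` (`q'` onto,
`ker q' = J_B L`). [cite: Schlessinger1968, Cor. 3.6, p. 217] -/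
theorem bijective_fiberProdLift_of_isBaseChange [IsArtinianRing R₁] [IsLocalRing R₁] [Module.Flat R₁ M₁]
    [Module.Flat R₂ M₂] (hq : Function.Surjective (algebraMap R₂ R₀))
    (hJ : IsNilpotent (RingHom.ker (algebraMap R₂ R₀))) (hu₂ : Function.Surjective u₂)
    (hker : LinearMap.ker u₂ = RingHom.ker (algebraMap R₂ R₀) • ⊤) (hu₁ : IsBaseChange R₀ (restrictSemilinear u₁))
    {L : Type*} [AddCommGroup L] [Module R₃ L] (q₁ : L →ₗ[R₃] M₁) (q₂ : L →ₗ[R₃] M₂)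
    (h : ∀ x, u₁ (q₁ x) = u₂ (q₂ x)) (hq₁ : Function.Surjective q₁)
    (hkq₁ : LinearMap.ker q₁ = RingHom.ker (algebraMap R₃ R₁) • ⊤) :
    Function.Bijective (fiberProdLift R₃ q₁ q₂ h) := by
  haveI : Module.Free R₁ M₁ := free_of_flat_of_isArtinianRing
  obtain ⟨b₀, h₁⟩ := exists_basis_of_isBaseChange hu₁ (Module.Free.chooseBasis R₁ M₁)
  exact bijective_fiberProdLift R₃ hc hcu hq hJ hu₂ hker _ b₀ h₁ q₁ q₂ h hq₁ hkq₁

end ArtinLocal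

end Basis

end Literature.RingTheory.Flat
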